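import Literature.NumberTheory.Transcendental.ClosingData
import Literature.NumberTheory.Transcendental.NewPointsScaled
import HarnessLib

/-!
# Baker's method on `M_κ`: the dichotomy theorem

Topic: `Literature/NumberTheory/Transcendental`. Plan item W4 (closing, part 2) of the unit
`provefact-Literature.NumberTheory.Transcendental.H-b596640137`. What the Baker engine
(`BakerEngine.engine`), Philippon's zero estimate (`philippon1986_std`), the index descent
(`Semistable.index_le`) and the orbit count (`OrbitCard`) yield TOGETHER for the data of the
Semistability Theorem — a semistable `ℚ̄`-rational `𝔟 ⊊ Lie M_κ` and `w ∈ 𝔟` with `exp(w)`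
algebraic with torsion abelian part — GIVEN admissible parameters for the Baker datum with
`dd = dim 𝔟` directions (hypothesis `hpar`; `AdmissibleParams` packages the engine's hypotheses
in the scaled form `NewPointsScaled.NumCond₂`/`engine₂` and the zero-estimate numerics). The
satisfiability of `AdmissibleParams` — the parameter bookkeeping of Baker–Wüstholz §6.8 p. 119,
with the choice `S = ℓS₀`, `T = S₀^A`, `(D'+1)^n ≈ 2(S₀+1)T^{dd}`, `R = ρ·2(nS+S₀)` — is NOT
proved in this file; it is the forthcoming parameter-choice item of the unit (see its NOTES), so
at present `dichotomy` is a conditional statement: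

**`dichotomy`** — there is a connected algebraic subgroup datum `K ≠ M_κ` (over `ℂ`) which is
BORDERLINE for semistability, `dim 𝔟·(n - dim 𝔨) = (dim 𝔟 - dim(𝔟 ∩ 𝔨))·n`, and a multiple
`r·w`, `r ≥ 1`, lying in `Lie K_ℂ + ker(exp)`. (All obstructions with full orbit, and all
non-borderline ones, are excluded by the numerics; `K = 0` borderline = `exp(w)` torsion.)
The Semistability Theorem itself (`w ∈ ker`) is this statement plus the treatment of the
borderline-periodic configurations (Philippon–Waldschmidt 1988 §5–6, Bertrand–Philippon 1988),
not formalised here.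

## References

* A. Baker, G. Wüstholz, *Logarithmic Forms and Diophantine Geometry*, CUP 2007, §6.8.
* P. Philippon, M. Waldschmidt, Illinois J. Math. 32 (1988), §5 (the two cases).
-/

noncomputable section

open Module Submodule Complex
open scoped PeriodPair

namespace Literature.NumberTheory.Transcendental

namespace GaGmE

namespace Std

open LiePresentation

variable {β γ δ : Type} [Fintype β] [Fintype γ] [Fintype δ] [DecidableEq γ] [DecidableEq β] [DecidableEq δ]

/-! ### The zero subgroup -/

variable (κM : δ → γ → Kbar) in
/-- The trivial subgroup `0 ≤ M_κ` (`A`, `C`, `Ξ` everything); companion of the whole group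
`SubgroupDataC.top` of `PhilipponZeroEstimateStd.lean`. [folklore] -/
def SubgroupDataC.zero : SubgroupDataC β γ δ κM where
  A := ⊤
  C := ⊤
  Ξ := ⊤
  compat := by
    intro ξ _
    -- every vector of `ℂ^γ` is in the span of the rational vectors
    have hspan : Submodule.span ℂ ((fun c : γ → ℚ => fun b => (c b : ℂ)) '' ((⊤ : Submodule ℚ (γ → ℚ)) : Set (γ → ℚ))) = ⊤ := by
      classical
      rw [eq_top_iff]
      rintro u -
      have hsingle : ∀ b : γ, (Pi.single b (1 : ℂ) : γ → ℂ) ∈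
          Submodule.span ℂ ((fun c : γ → ℚ => fun b => (c b : ℂ)) '' ((⊤ : Submodule ℚ (γ → ℚ)) : Set (γ → ℚ))) := by
        intro b
        refine Submodule.subset_span ⟨Pi.single b 1, trivial, ?_⟩
        funext b'
        by_cases h : b' = b
        · subst h; simp
        · simp [h]
      rw [pi_eq_sum_univ u]
      refine Submodule.sum_mem _ fun b _ => Submodule.smul_mem _ _ ?_
      have e : (fun j => if b = j then (1 : ℂ) else 0) = Pi.single b (1 : ℂ) := by
        funext j; by_cases h : j = b
        · subst h; simp
        · simp [h, Ne.symm h]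
      rw [e]; exact hsingle b
    rw [hspan]
    trivial

omit [DecidableEq β] [DecidableEq δ] in
/-- `Lie 0 = 0`. [folklore] -/
theorem SubgroupDataC.tangent_zero {κM : δ → γ → Kbar} :
    (SubgroupDataC.zero κM : SubgroupDataC β γ δ κM).tangent = ⊥ := by
  classical
  rw [eq_bot_iff]
  intro w hw
  rw [SubgroupDataC.mem_tangent_iff] at hw
  obtain ⟨hA, hC, hΞ⟩ := hw
  rw [Submodule.mem_bot]
  funext i
  rcases i with j | b | e
  · have := hA (Pi.single j 1) trivial
    simp only [Pi.single_apply, apply_ite ((↑) : ℚ → ℂ), Rat.cast_one, Rat.cast_zero, ite_mul, one_mul,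
      zero_mul, Finset.sum_ite_eq', Finset.mem_univ, if_true] at this
    simpa [iy] using this
  · have := hC (Pi.single b 1) trivial
    simp only [Pi.single_apply, apply_ite ((↑) : ℚ → ℂ), Rat.cast_one, Rat.cast_zero, ite_mul, one_mul,
      zero_mul, Finset.sum_ite_eq', Finset.mem_univ, if_true] at this
    simpa [iz] using this
  · have := hΞ (Pi.single e 1) trivial
    simp only [Pi.single_apply, ite_mul, one_mul, zero_mul, Finset.sum_ite_eq', Finset.mem_univ, if_true] at this
    simpa [is] using this

/-! ### The dichotomy theorem -/

/-- The admissible-parameter hypothesis of the dichotomy theorem: for the Baker datum `B` and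
the constant `c > 0` there are parameters `D', T, S₀, S, T″, R` with the hypotheses of the scaled
engine `NewPointsScaled.engine₂` (`T ≥ 1`, Siegel feasibility `(S₀+1)T^{dd} < (D'+1)^n`,
`R ≥ 2(nS + S₀)`, the numerical condition `NumCond₂` for every coefficient vector within the Siegel
bound, with `S₁ = nS`, `T' = nT″ + 1`), `D' ≥ 1`, `S ≥ 1`, and the zero-estimate numerics: for
all `e, m` with `m < n` and `d·(n - m) ≤ e·n` (`d` the intended `dim 𝔟`),
`c·D^n < binom(T″+e, e)·(S+1)·D^m`, and `c·D^n < binom(T″+e, e)·D^m` when the index inequality is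
strict (`D = nD'`). Its satisfiability (for `B.dd = d < n`) is the parameter bookkeeping of the
source, not proved here. [cite: BakerWustholz2007, §6.8 (p. 119: choice of D, T, S)] -/
def AdmissibleParams (B : BakerData β γ δ) (d𝔟 : ℕ) (c : ℝ) : Prop :=
  ∃ (D' T S₀ S T'' : ℕ) (R : ℝ), 0 < T ∧ 1 ≤ D' ∧ 1 ≤ S ∧
    (S₀ + 1) * T ^ B.dd < (D' + 1) ^ Fintype.card (β ⊕ (γ ⊕ δ)) ∧ 0 < R ∧
    2 * (((Fintype.card (β ⊕ (γ ⊕ δ)) * S : ℕ) : ℝ) + S₀) ≤ R ∧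
    (∀ ξ : BakerData.UIdx β γ δ D' → NumberField.RingOfIntegers B.K,
      (∀ u, NumberField.house ((ξ u : NumberField.RingOfIntegers B.K) : B.K) ≤ B.siegelHouseBound D' T S₀) →
        B.NumCond₂ ξ T S₀ (Fintype.card (β ⊕ (γ ⊕ δ)) * S) (Fintype.card (β ⊕ (γ ⊕ δ)) * T'' + 1) R) ∧
    ∀ e m : ℕ, m < Fintype.card (β ⊕ (γ ⊕ δ)) → d𝔟 * (Fintype.card (β ⊕ (γ ⊕ δ)) - m) ≤ e * Fintype.card (β ⊕ (γ ⊕ δ)) →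
      c * ((Fintype.card (β ⊕ (γ ⊕ δ)) * D' : ℕ) : ℝ) ^ Fintype.card (β ⊕ (γ ⊕ δ)) <
          (Nat.choose (T'' + e) e : ℝ) * ((S : ℝ) + 1) * ((Fintype.card (β ⊕ (γ ⊕ δ)) * D' : ℕ) : ℝ) ^ m ∧
      (d𝔟 * (Fintype.card (β ⊕ (γ ⊕ δ)) - m) < e * Fintype.card (β ⊕ (γ ⊕ δ)) →
        c * ((Fintype.card (β ⊕ (γ ⊕ δ)) * D' : ℕ) : ℝ) ^ Fintype.card (β ⊕ (γ ⊕ δ)) <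
          (Nat.choose (T'' + e) e : ℝ) * ((Fintype.card (β ⊕ (γ ⊕ δ)) * D' : ℕ) : ℝ) ^ m)

/-- **The dichotomy theorem of Baker's method on `M_κ`.** Let `Λ` have algebraic invariants
and no CM, `𝔟 ⊊ Lie M_κ` `ℚ̄`-rational and semistable, `w ∈ 𝔟` with `exp(w)` algebraic with
torsion abelian part. Assume Philippon's zero estimate, and admissible parameters (for every
constant) for every Baker datum with period pair `L`, extension data `κ`, point `w` and
`dd = dim 𝔟` directions spanning `𝔟` (exactly the data produced by `ClosingData.exists_bakerData`).
Then there is a connected algebraic subgroup datum `K ≠ M_κ`, borderline for semistability,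
with a multiple `r·w` (`r ≥ 1`) in `Lie K_ℂ + ker`. Conditional on the satisfiability of
`AdmissibleParams` (see the module docstring). [cite: BakerWustholz2007, §6.8 (pp. 118–119)] -/
theorem dichotomy (hphil : philippon1986_std) (L : PeriodPair) (h₂ : IsAlgebraic ℚ L.g₂)
    (h₃ : IsAlgebraic ℚ L.g₃) (hCM : ¬ L.HasCM) (κM : δ → γ → Kbar)
    {𝔟 : Submodule ℂ (β ⊕ (γ ⊕ δ) → ℂ)} (hrat : IsKRational Kbar 𝔟) (h𝔟 : 𝔟 ≠ ⊤)
    (hss : Semistable κM 𝔟) {w : β ⊕ (γ ⊕ δ) → ℂ} (hw𝔟 : w ∈ 𝔟) (hw : w ∈ AlgTors L κM)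
    (hpar : ∀ B : BakerData β γ δ, B.L = L → B.κM = κM → B.v = w → B.dd = Module.finrank ℂ 𝔟 →
      Submodule.span ℂ (Set.range B.xs) = 𝔟 → ∀ c : ℝ, 0 < c → AdmissibleParams B (Module.finrank ℂ 𝔟) c) :
    ∃ K : SubgroupDataC β γ δ κM, K.tangent ≠ ⊤ ∧
      Module.finrank ℂ 𝔟 * (Fintype.card (β ⊕ (γ ⊕ δ)) - Module.finrank ℂ K.tangent) =
        (Module.finrank ℂ 𝔟 - Module.finrank ℂ ↥(𝔟 ⊓ K.tangent)) * Fintype.card (β ⊕ (γ ⊕ δ)) ∧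
      ∃ r : ℕ, 0 < r ∧ (r : ℂ) • w ∈ preimageSubgroup L κM K := by
  classical
  set n := Fintype.card (β ⊕ (γ ⊕ δ)) with hn
  -- `n ≥ 1` and `dim 𝔟 < n`
  have h𝔟lt : Module.finrank ℂ 𝔟 < n := by
    have := Submodule.finrank_lt h𝔟; simpa [hn] using this
  -- the degenerate case `𝔟 = 0`: `w = 0`, take `K = 0`
  by_cases h0 : Module.finrank ℂ 𝔟 = 0
  · have h𝔟0 : 𝔟 = ⊥ := Submodule.finrank_eq_zero.mp h0
    have hw0 : w = 0 := by rw [h𝔟0, Submodule.mem_bot] at hw𝔟; exact hw𝔟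
    refine ⟨SubgroupDataC.zero κM, ?_, ?_, 1, one_pos, ?_⟩
    · rw [SubgroupDataC.tangent_zero]
      intro h
      have : Module.finrank ℂ (⊥ : Submodule ℂ (β ⊕ (γ ⊕ δ) → ℂ)) = Module.finrank ℂ (⊤ : Submodule ℂ (β ⊕ (γ ⊕ δ) → ℂ)) := by
        rw [h]
      rw [finrank_bot, finrank_top, Module.finrank_fintype_fun_eq_card, ← hn] at this
      omega
    · rw [h0]; simp
    · rw [hw0, smul_zero]; exact AddSubgroup.zero_mem _
  have h𝔟pos : 0 < Module.finrank ℂ 𝔟 := Nat.pos_of_ne_zero h0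
  -- the Baker datum and Philippon's constant
  obtain ⟨B, hBL, hBκ, hBv, hBdd, hBspan⟩ := exists_bakerData L h₂ h₃ κM hrat hw
  obtain ⟨c, hc, hZ⟩ := hphil L h₂ h₃ hCM β γ δ κM
  obtain ⟨D', T, S₀, S, T'', R, hT, hD', hS, hpq, hR0, hR, hnum, hineq⟩ := hpar B hBL hBκ hBv hBdd hBspan c hc
  -- run the engine
  have hv : B.v ∈ B.bSpan := by
    show B.v ∈ Submodule.span ℂ (Set.range B.xs)
    rw [hBspan, hBv]; exact hw𝔟
  obtain ⟨P, hP, hne, hvan⟩ := B.engine₂ hv D' T S₀ (n * S) (n * T'' + 1) R hT hpq hR0 (by exact_mod_cast hR) hnum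
  -- Philippon's zero estimate
  have hD1 : 1 ≤ n * D' := Nat.one_le_iff_ne_zero.mpr (Nat.mul_ne_zero (by omega) (by omega))
  have hvan' : ∀ s : ℕ, s ≤ n * S → VanishesAlong 𝔟 (thetaEval L κM P) ((s : ℂ) • w) (n * T'' + 1) := by
    intro s hs
    have := hvan s hs
    rwa [show B.bSpan = 𝔟 from hBspan, hBL, hBκ, hBv] at this
  have hne' : ∃ w', thetaEval L κM P w' ≠ 0 := by rwa [hBL, hBκ] at hne
  obtain ⟨K, ⟨w₀, hw₀⟩, hK⟩ := hZ 𝔟 w P (n * D') S T'' h𝔟pos hD1 hS hP hne' hvan'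
  -- `K ≠ M_κ`
  have hKtop : K.tangent ≠ ⊤ := by
    intro htop
    obtain ⟨w', hw'⟩ := hne'
    apply hw'
    have := hw₀ (w' - w₀) (by rw [htop]; trivial)
    simpa using this
  have hm : Module.finrank ℂ K.tangent < n := by
    have := Submodule.finrank_lt hKtop; simpa [hn] using this
  -- the index inequality
  have hidx := hss.index_le κM hrat K hKtop
  set e := Module.finrank ℂ 𝔟 - Module.finrank ℂ ↥(𝔟 ⊓ K.tangent) with he
  set m := Module.finrank ℂ K.tangent with hm'
  obtain ⟨hfull, hstrict⟩ := hineq e m hm hidx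
  -- orbit dichotomy
  have horb_le := orbitCard_le L κM K w S
  have hD0 : (0 : ℝ) < ((n * D' : ℕ) : ℝ) := by exact_mod_cast hD1
  by_cases horb : orbitCard L κM K w S = S + 1
  · -- full orbit: numerics contradict Philippon
    exfalso
    rw [horb] at hK
    rw [← hn] at hK hfull
    push_cast at hK hfull
    linarith
  · -- small orbit: a multiple of `w` meets `Lie K + ker`; then `K` must be borderline
    obtain ⟨r, hr, -, hrmem⟩ := orbitCard_lt_imp L κM K w S (lt_of_le_of_ne horb_le horb)
    refine ⟨K, hKtop, ?_, r, hr, hrmem⟩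
    by_contra hneq
    have hlt : Module.finrank ℂ 𝔟 * (n - m) < e * n := lt_of_le_of_ne hidx hneq
    have h1 := hstrict hlt
    have horb1 : (1 : ℝ) ≤ orbitCard L κM K w S := by exact_mod_cast one_le_orbitCard L κM K w S
    have h2 : (Nat.choose (T'' + e) e : ℝ) * ((n * D' : ℕ) : ℝ) ^ m ≤
        (Nat.choose (T'' + e) e : ℝ) * (orbitCard L κM K w S : ℝ) * ((n * D' : ℕ) : ℝ) ^ m := by
      have hch : (0 : ℝ) ≤ (Nat.choose (T'' + e) e : ℝ) := Nat.cast_nonneg _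
      have hpow : (0 : ℝ) ≤ ((n * D' : ℕ) : ℝ) ^ m := by positivity
      rw [show (Nat.choose (T'' + e) e : ℝ) * ((n * D' : ℕ) : ℝ) ^ m =
        (Nat.choose (T'' + e) e : ℝ) * 1 * ((n * D' : ℕ) : ℝ) ^ m from by ring]
      exact mul_le_mul_of_nonneg_right (mul_le_mul_of_nonneg_left horb1 hch) hpow
    rw [← hn] at hK h1
    push_cast at hK h1 h2
    linarith

end Std

end GaGmE

end Literature.NumberTheory.Transcendental

end
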